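import Summits.QuantumFields.YangMills.Theorems.BalabanUVNodesN15KingModelTorusReflectionPositivity
import Summits.QuantumFields.YangMills.Theorems.BalabanUVNodesN15KingModelTwoPointFiniteKInfiniteVolume
import Literature.Probability.LatticeModels.ReflectionPositivityProofs
import HarnessLib

/-!
# BalabanUVNodes ∕ N15 — THE KING-MODEL RUNG (PART Ϗ-c): REFLECTION POSITIVITY OF KING's TORUS LAWS FOR EVERY BLOCK-FACE HYPERPLANE —
# all translates `x_κ ↦ 2t_κ − 1 − x_κ` of the reflection between sites, in every direction with an even side, for the fine free field, the fluctuation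
# covariance `A₀⁻¹`, the block-averaged law `N(0, S₂^{(K)})` and the RG block-field laws `dμ^{(K)} = N(0, (Δ^{(K)})⁻¹)`; on Bałaban's volumes `Π ℤ∕(2L^m)` these
# are LITERALLY the tree's FILS reflections `Torus.reflectBetweenSites κ k` with positive halves `Torus.halfBetweenSites κ k` — the hypothesis of the chessboard estimate
# (Track A, DAG node N15 = NE2; FAN-OUT v1.1 §N15 s3 «KING-MODEL RUNG»; count-neutral)

HONEST FRAMING.  Count-neutral (cell `pub-ymgap`, seat `pub-ymgap-dag-n15-e` g37; `--supports stmt-QuantumFields-27366 --as helper` = K3⁸).  King's `A = 0`, `g = 0` model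
([King1986] (2.10)–(2.14) pp.652–653, (4.1)–(4.5) p.670).  Parts Ϗ-a∕Ϗ-b proved reflection positivity for ONE hyperplane per direction (the block face between
`x_κ = −1` and `x_κ = 0`, dag-n15-a's `torRefl`).  King's kernels are TRANSLATION INVARIANT (part Ϙ: `lapF_inv_transl`, `fineOp_inv_transl`, `kingS2_transl`,
`blockCov_transl`), so the reflected positivity transports to every translate: ★ `reflected_nonneg_transport` (generic: a symmetry `τ` of the kernel carries vector-level
reflected positivity from `(θ, P)` to `(τθτ⁻¹, τP)`), the shifted reflection `σ_{κ,t} x = σ_κ(x − t) + t` (`x_κ ↦ 2t_κ − 1 − x_κ`, an involution leaving every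
translation- and `σ_κ`-invariant kernel invariant) and half `{val (x − t)_κ < K_κ∕2}`.  RESULTS (`K_κ` resp. `M_κ` even, `m² > 0`): ★★★ `freeField_isReflectionPositive_plane`,
★★ `kingFluctuation_isReflectionPositive_plane`, ★★★ `fineBlockLaw_isReflectionPositive_plane`, ★★★ **`blockFieldLaw_isReflectionPositive_plane`** — King's RG block-field law
`N(0, (Δ^{(K)})⁻¹)` is reflection positive on all bounded observables of EVERY half torus bounded by block faces, every direction, every `K ≥ 1`; and ★★★
**`blockFieldLaw_isReflectionPositive_betweenSites`**: on the King-model family's tori `Π ℤ∕(2L^m)` the statement reads, in the tree's FILS vocabulary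
(`Literature.Probability.LatticeModels.Torus`), `IsReflectionPositive (N(0,(Δ^{(K)})⁻¹)) (reflectBetweenSites κ k) (halfBetweenSites κ k)` for EVERY `κ` and EVERY `k`
(★ `shiftedRefl_eq_reflectBetweenSites`, ★ `mem_shiftedHalf_iff_mem_halfBetweenSites`); ★★ `blockFieldLaw_rp_cauchySchwarz`: the reflection Cauchy–Schwarz inequality
(the tree's `rp_cauchySchwarz_holds`) for King's block fields.  NOT Bałaban's covariant objects; NOT a node discharge; NOT chessboard∕infrared bounds themselves; nothing
continuum ∕ `ℝ⁴` ∕ OS axioms ∕ mass gap ∕ Clay.  0 `sorry`, 0 `def`.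

WHAT THIS FILE PROVES (kernel).  §1 ★ `reflected_nonneg_transport`; §2 `shiftedRefl_involutive`, `shiftedRefl_add`, `mem_shiftedHalf_add_iff`, `shiftedRefl_invariant`;
`shifted_nonneg_of_base`; §3 `lapF_inv_base_nonneg`, ★★★ `freeField_isReflectionPositive_plane`, ★★ `kingFluctuation_isReflectionPositive_plane` (block translates), `kingS2_base_nonneg`,
★★★ `fineBlockLaw_isReflectionPositive_plane`, `blockCov_base_nonneg`, ★★★ **`blockFieldLaw_isReflectionPositive_plane`**; §4 `val_add_one_of_lt`, `val_add_one_eq_mod`,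
★ `mem_shiftedHalf_iff_mem_halfBetweenSites`, ★ `shiftedRefl_eq_reflectBetweenSites`, `shiftedReflPerm_eq_reflectBetweenSites`, `shiftedHalf_eq_halfBetweenSites`,
★★★ **`blockFieldLaw_isReflectionPositive_betweenSites`**, `blockFieldLaw_isReflectionInvariant_betweenSites`, ★★ `blockFieldLaw_rp_cauchySchwarz`,
★★★ `king_torusRP_package`, `kingVol_eq`.

Locators (use): [King1986] (2.6) p.652, (2.10)–(2.14) pp.652–653, (4.5) p.670, (4.41) p.675; Glimm–Jaffe 1987 §7.10 Thm. 7.10.3; FILS 1978 §2 (torus reflections), Thm. 2.1;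
Biskup 2009 §5.1 Def. 5.2 (`𝕋_L^±`).
-/

noncomputable section

open scoped BigOperators
open Finset Matrix MeasureTheory

namespace Summit.QuantumFields.YangMills.BalabanUVNodes.N15KingModelRung.TorusRP

open Literature.MathematicalPhysics.QuantumFieldTheory (IsPosSemidefKernel gaussianFieldOfKernel)
open Literature.MathematicalPhysics.QuantumFieldTheory.Balaban1983to89.B5Prop11Plancherel (Tor fine unitVec)
open Literature.MathematicalPhysics.QuantumFieldTheory.Balaban1983to89.B5Block118 (up)
open Literature.MathematicalPhysics.QuantumFieldTheory.Balaban1983to89.QGQInverse (Coercive)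
open Literature.MathematicalPhysics.QuantumFieldTheory.King1986 (aK aK_pos)
open Literature.MathematicalPhysics.QuantumFieldTheory.King1986.Torus (lapF lapF_comm lapF_coercive lapF_transl Qmat fineOp blockProj blockOf effLaplacian
  fineOp_coercive fineOp_transpose)
open Literature.Probability.LatticeModels (IsReflectionPositive IsReflectionPositiveReal IsReflectionInvariant positiveEvents configReflect
  reflectedCovariance_nonneg_of_precision' isPosSemidefKernel_inv_of_posDef gaussianField_isReflectionPositive_of_vector gaussianField_isReflectionInvariant
  reflect_right_eq_reflect_left rp_cauchySchwarz_holds)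
open Literature.Probability.LatticeModels.Torus (reflectBetweenSites halfBetweenSites reflectBetweenSites_apply)
open Summit.QuantumFields.YangMills.BalabanUVNodes.N15.TwoGrid (torRefl torRefl_torRefl torRefl_apply_same torRefl_apply_ne torRefl_injective torRefl_add)
open Summit.QuantumFields.YangMills.BalabanUVNodes.N15.KingModel.SrcDiv (val_torRefl_same lapF_torRefl fineOp_torRefl)
open Summit.QuantumFields.YangMills.BalabanUVNodes.N15KingModelRung.Curved (lapF_inv_torRefl effLaplacian_torRefl blockCov_torRefl blockCov_transl)
open Summit.QuantumFields.YangMills.BalabanUVNodes.N15KingModelRung.Transl (lapF_inv_transl fineOp_inv_transl)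

variable {d : ℕ}

/-! ## §1 Transport of reflected positivity along a symmetry of the kernel -/

section Transport

variable {V : Type*} [Fintype V]

/-- ★ **TRANSPORT**: if `τ` is a symmetry of the kernel (`K(τa, τb) = K(a, b)`), `θ′ ∘ τ = τ ∘ θ` and `τ⁻¹P′ = P`, then vector-level reflected positivity of `K` for
`(θ, P)` gives it for `(θ′, P′)` — substitute `x = τx′`, `y = τy′`. [cite: FILS1978, §2 (translates of the reflection planes)] [cite: GlimmJaffe1987, §7.10 Def. 7.10.2] -/
theorem reflected_nonneg_transport (K : V → V → ℝ) (τ : V ≃ V) (hK : ∀ a b, K (τ a) (τ b) = K a b) {θ θ' : V → V}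
    (hθ' : ∀ x, θ' (τ x) = τ (θ x)) {P P' : Set V} (hP' : ∀ x, τ x ∈ P' ↔ x ∈ P)
    (h : ∀ u : V → ℝ, (∀ x, x ∉ P → u x = 0) → 0 ≤ ∑ x, ∑ y, u x * K (θ x) y * u y)
    (u : V → ℝ) (hu : ∀ x, x ∉ P' → u x = 0) : 0 ≤ ∑ x, ∑ y, u x * K (θ' x) y * u y := by
  have h1 := h (fun x => u (τ x)) (fun x hx => hu (τ x) (fun h' => hx ((hP' x).mp h')))
  have e : ∑ x, ∑ y, u (τ x) * K (θ x) y * u (τ y) = ∑ x, ∑ y, u x * K (θ' x) y * u y :=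
    Fintype.sum_equiv τ _ _ fun x => Fintype.sum_equiv τ _ _ fun y => by rw [hθ', hK]
  rw [← e]
  exact h1

end Transport

/-! ## §2 The shifted block-face reflections `σ_{κ,t} x = σ_κ(x − t) + t` and halves `{val (x − t)_κ < K_κ∕2}` -/

section Shifted

variable {K : Fin (d + 1) → ℕ} [∀ μ, NeZero (K μ)] (κ : Fin (d + 1)) (t : Tor K)

omit [∀ μ, NeZero (K μ)] in
/-- `σ_{κ,t}` is an involution. [cite: FILS1978, §2] -/
theorem shiftedRefl_involutive : Function.Involutive (fun x : Tor K => torRefl K κ (x - t) + t) := fun x => by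
  simp only [add_sub_cancel_right, torRefl_torRefl, sub_add_cancel]

omit [∀ μ, NeZero (K μ)] in
/-- `σ_{κ,t}(x + t) = σ_κ x + t`. [cite: FILS1978, §2] -/
theorem shiftedRefl_add (x : Tor K) : torRefl K κ (x + t - t) + t = torRefl K κ x + t := by
  rw [add_sub_cancel_right]

omit [∀ μ, NeZero (K μ)] in
/-- `x + t ∈ {val (· − t)_κ < K_κ∕2} ↔ x ∈ {val x_κ < K_κ∕2}`. [cite: Biskup2009, §5.1 Def. 5.2] -/
theorem mem_shiftedHalf_add_iff (x : Tor K) :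
    x + t ∈ {x : Tor K | ((x - t) κ).val < K κ / 2} ↔ x ∈ {x : Tor K | (x κ).val < K κ / 2} := by
  simp only [Set.mem_setOf_eq, add_sub_cancel_right]

omit [∀ μ, NeZero (K μ)] in
/-- A translation- and `σ_κ`-invariant kernel is `σ_{κ,t}`-invariant. [cite: FILS1978, §2] -/
theorem shiftedRefl_invariant {G : Tor K → Tor K → ℝ} (htr : ∀ a b (v : Tor K), G (a + v) (b + v) = G a b)
    (hre : ∀ a b, G (torRefl K κ a) (torRefl K κ b) = G a b) (a b : Tor K) :
    G (torRefl K κ (a - t) + t) (torRefl K κ (b - t) + t) = G a b := by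
  rw [htr, hre, ← htr (a - t) (b - t) t, sub_add_cancel, sub_add_cancel]

/-- Transport of vector-level reflected positivity from the block face `(σ_κ, {val x_κ < K_κ∕2})` to its translate by `t`, for a translation-invariant kernel.
[cite: FILS1978, §2] [cite: GlimmJaffe1987, §7.10 Thm. 7.10.3] -/
theorem shifted_nonneg_of_base {G : Tor K → Tor K → ℝ} (htr : ∀ a b (v : Tor K), G (a + v) (b + v) = G a b)
    (h : ∀ u : Tor K → ℝ, (∀ x, x ∉ {x : Tor K | (x κ).val < K κ / 2} → u x = 0) → 0 ≤ ∑ x, ∑ y, u x * G (torRefl K κ x) y * u y)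
    (u : Tor K → ℝ) (hu : ∀ x, x ∉ {x : Tor K | ((x - t) κ).val < K κ / 2} → u x = 0) :
    0 ≤ ∑ x, ∑ y, u x * G (torRefl K κ (x - t) + t) y * u y :=
  reflected_nonneg_transport G (Equiv.addRight t) (fun a b => htr a b t) (θ := torRefl K κ) (θ' := fun x => torRefl K κ (x - t) + t)
    (fun x => shiftedRefl_add κ t x) (P := {x : Tor K | (x κ).val < K κ / 2}) (fun x => mem_shiftedHalf_add_iff κ t x) h u hu

end Shifted

/-! ## §3 Reflection positivity of King's torus laws for every block-face hyperplane -/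

section Planes

variable {K : Fin (d + 1) → ℕ} [∀ μ, NeZero (K μ)] (N : ℕ) [NeZero N] (M : Fin (d + 1) → ℕ) [∀ μ, NeZero (M μ)] (κ : Fin (d + 1))

/-- Base plane, vector form: `0 ≤ Σ_{x,y} u_x B⁻¹(σ_κ x, y) u_y` for `u` supported in `{val x_κ < K_κ∕2}` (part Ϗ-a). [cite: King1986, (4.4) p.670] [cite: GlimmJaffe1987, §7.10 Thm. 7.10.3] -/
theorem lapF_inv_base_nonneg (hK : Even (K κ)) {c m2 : ℝ} (hc : 0 ≤ c) (hm : 0 < m2) (u : Tor K → ℝ)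
    (hu : ∀ x, x ∉ {x : Tor K | (x κ).val < K κ / 2} → u x = 0) :
    0 ≤ ∑ x, ∑ y, u x * (lapF K c m2)⁻¹ (torRefl K κ x) y * u y :=
  reflectedCovariance_nonneg_of_precision' (lapF_posDef hc hm) (θ := Function.Involutive.toPerm (torRefl K κ) torRefl_torRefl) torRefl_torRefl
    (fun x y => lapF_torRefl κ c m2 x y) (P := {x : Tor K | (x κ).val < K κ / 2}) (torRefl_mem_half_iff κ hK) (lapF_cut_nonpos κ hK hc m2) u hu

/-- ★★★ **THE FREE FIELD `N(0, B⁻¹)` IS REFLECTION POSITIVE FOR EVERY BLOCK-FACE HYPERPLANE**: for every `t` (the face between `x_κ = t_κ − 1` and `x_κ = t_κ`), `K_κ` even,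
`c ≥ 0`, `m² > 0`. [cite: King1986, (2.13) p.653, (4.4) p.670] [cite: GlimmJaffe1987, §7.10 Thm. 7.10.3] [cite: FILS1978, §2, Thm. 2.1] -/
theorem freeField_isReflectionPositive_plane (hK : Even (K κ)) {c m2 : ℝ} (hc : 0 ≤ c) (hm : 0 < m2) (t : Tor K) :
    IsReflectionPositive (gaussianFieldOfKernel fun z z' : Tor K => (lapF K c m2)⁻¹ z z')
      (Function.Involutive.toPerm _ (shiftedRefl_involutive κ t)) {x : Tor K | ((x - t) κ).val < K κ / 2} :=
  gaussianField_isReflectionPositive_of_vector (isPosSemidefKernel_inv_of_posDef (lapF_posDef hc hm))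
    (Function.Involutive.toPerm _ (shiftedRefl_involutive κ t))
    (fun a b => shiftedRefl_invariant κ t (fun a b v => lapF_inv_transl K c m2 a b v) (fun a b => lapF_inv_torRefl κ K c m2 a b) a b)
    (shiftedRefl_involutive κ t) (shifted_nonneg_of_base κ t (fun a b v => lapF_inv_transl K c m2 a b v) (lapF_inv_base_nonneg κ hK hc hm))

/-- ★★ **KING's FLUCTUATION COVARIANCE `A₀⁻¹` IS REFLECTION POSITIVE FOR EVERY BLOCK-FACE HYPERPLANE through block boundaries**: every translate by a BLOCK vector `N·v`
(`M_κ` even, `a, c ≥ 0`, `m² > 0`). [cite: King1986, (2.13) p.653, (4.5) p.670] [cite: GlimmJaffe1987, §7.10 Thm. 7.10.3] -/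
theorem kingFluctuation_isReflectionPositive_plane (hM : Even (M κ)) {a c m2 : ℝ} (ha : 0 ≤ a) (hc : 0 ≤ c) (hm : 0 < m2) (v : Tor M) :
    IsReflectionPositive (gaussianFieldOfKernel fun x y : Tor (fine N M) => (fineOp N M a c m2)⁻¹ x y)
      (Function.Involutive.toPerm _ (shiftedRefl_involutive κ (up N M v)))
      {x : Tor (fine N M) | ((x - up N M v) κ).val < fine N M κ / 2} := by
  have htr : ∀ a' b' (w : Tor M), (fineOp N M a c m2)⁻¹ (a' + up N M w) (b' + up N M w) = (fineOp N M a c m2)⁻¹ a' b' :=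
    fun a' b' w => fineOp_inv_transl N M a c m2 a' b' w
  have hre : ∀ a' b', (fineOp N M a c m2)⁻¹ (torRefl (fine N M) κ a') (torRefl (fine N M) κ b') = (fineOp N M a c m2)⁻¹ a' b' :=
    fun a' b' => Literature.Probability.LatticeModels.inv_apply_equiv_of_invariant
      (Function.Involutive.toPerm (torRefl (fine N M) κ) torRefl_torRefl) (fun x y => fineOp_torRefl κ N M a c m2 x y) a' b'
  refine gaussianField_isReflectionPositive_of_vector (isPosSemidefKernel_inv_of_posDef (fineOp_posDef N M ha hc hm))
    (Function.Involutive.toPerm _ (shiftedRefl_involutive κ (up N M v))) (fun a' b' => ?_) (shiftedRefl_involutive κ _) ?_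
  · show (fineOp N M a c m2)⁻¹ (torRefl (fine N M) κ (a' - up N M v) + up N M v)
        (torRefl (fine N M) κ (b' - up N M v) + up N M v) = (fineOp N M a c m2)⁻¹ a' b'
    rw [htr, hre, ← htr (a' - up N M v) (b' - up N M v) v, sub_add_cancel, sub_add_cancel]
  · intro u hu
    refine reflected_nonneg_transport (fun x y => (fineOp N M a c m2)⁻¹ x y) (Equiv.addRight (up N M v)) (fun a' b' => htr a' b' v)
      (θ := torRefl (fine N M) κ) (θ' := fun x => torRefl (fine N M) κ (x - up N M v) + up N M v)
      (fun x => shiftedRefl_add κ _ x) (P := {x : Tor (fine N M) | (x κ).val < fine N M κ / 2}) (fun x => mem_shiftedHalf_add_iff κ _ x) ?_ u hu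
    intro w hw
    exact reflectedCovariance_nonneg_of_precision' (fineOp_posDef N M ha hc hm) (θ := Function.Involutive.toPerm (torRefl (fine N M) κ) torRefl_torRefl)
      torRefl_torRefl (fun x y => fineOp_torRefl κ N M a c m2 x y) (P := {x : Tor (fine N M) | (x κ).val < fine N M κ / 2})
      (torRefl_mem_half_iff κ (even_fine N M κ hM)) (fineOp_cut_nonpos N M κ hM a hc m2) w hw

/-- Base plane, vector form for `S₂^{(K)}` with the reflection on the left. [cite: King1986, (2.13) p.653] [cite: GlimmJaffe1987, §7.10 Thm. 7.10.3] -/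
theorem kingS2_base_nonneg (hM : Even (M κ)) {m2 : ℝ} (hm : 0 < m2) (u : Tor M → ℝ) (hu : ∀ b, b ∉ {b : Tor M | (b κ).val < M κ / 2} → u b = 0) :
    0 ≤ ∑ b, ∑ b', u b * kingS2 N M m2 (torRefl M κ b) b' * u b' := by
  refine (kingS2_reflected_nonneg N M κ hM hm u hu).trans_eq (Finset.sum_congr rfl fun b _ => Finset.sum_congr rfl fun b' _ => ?_)
  rw [reflect_right_eq_reflect_left (θ := torRefl M κ) (fun a b => kingS2_torRefl N M κ m2 a b) torRefl_torRefl]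

/-- ★★★ **THE BLOCK-AVERAGED LAW `N(0, S₂^{(K)})` IS REFLECTION POSITIVE FOR EVERY BLOCK-FACE HYPERPLANE** of the unit torus (`M_κ` even, `m² > 0`, every translate `t`).
[cite: King1986, (2.13) p.653, Thm 2.1 (2.23) p.654] [cite: GlimmJaffe1987, §7.10 Thm. 7.10.3] [cite: FILS1978, §2, Thm. 2.1] -/
theorem fineBlockLaw_isReflectionPositive_plane (hM : Even (M κ)) {m2 : ℝ} (hm : 0 < m2) (t : Tor M) :
    IsReflectionPositive (gaussianFieldOfKernel (kingS2 N M m2)) (Function.Involutive.toPerm _ (shiftedRefl_involutive κ t))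
      {b : Tor M | ((b - t) κ).val < M κ / 2} :=
  gaussianField_isReflectionPositive_of_vector (isPosSemidefKernel_kingS2 N M hm) (Function.Involutive.toPerm _ (shiftedRefl_involutive κ t))
    (fun a b => shiftedRefl_invariant κ t (fun a b v => kingS2_transl N M hm a b v) (fun a b => kingS2_torRefl N M κ m2 a b) a b)
    (shiftedRefl_involutive κ t) (shifted_nonneg_of_base κ t (fun a b v => kingS2_transl N M hm a b v) (kingS2_base_nonneg N M κ hM hm))

variable (L : ℕ)

/-- Base plane, vector form for `(Δ^{(K)})⁻¹` with the reflection on the left (precision criterion on `Δ^{(K)}`, part Ϗ-b). [cite: King1986, (2.14) p.653, (4.5) p.670] -/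
theorem blockCov_base_nonneg (hL : 2 ≤ L) (hM : Even (M κ)) {a m2 : ℝ} (ha : 0 < a) (hm : 0 < m2) {K' : ℕ} (hK : 1 ≤ K') (u : Tor M → ℝ)
    (hu : ∀ b, b ∉ {b : Tor M | (b κ).val < M κ / 2} → u b = 0) :
    haveI : NeZero L := ⟨by omega⟩
    0 ≤ ∑ b, ∑ b', u b * blockCov L (L ^ K') M a m2 K' (torRefl M κ b) b' * u b' := by
  haveI : NeZero L := ⟨by omega⟩
  have hN2 : (0 : ℝ) ≤ ((L ^ K' : ℕ) : ℝ) ^ 2 := by positivity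
  exact reflectedCovariance_nonneg_of_precision' (effLaplacian_posDef M L hL ha hm hK) (θ := Function.Involutive.toPerm (torRefl M κ) torRefl_torRefl)
    torRefl_torRefl (fun x y => effLaplacian_torRefl (L ^ K') M κ _ _ _ x y) (P := {b : Tor M | (b κ).val < M κ / 2}) (torRefl_mem_half_iff κ hM)
    (effLaplacian_cut_nonpos (L ^ K') M κ hM (aK_pos ha (by exact_mod_cast (show 1 < L by omega)) hK).le hN2 hm) u hu

/-- ★★★ **KING's RG BLOCK-FIELD LAW `dμ^{(K)} = N(0, (Δ^{(K)})⁻¹)` IS REFLECTION POSITIVE FOR EVERY BLOCK-FACE HYPERPLANE**: for every direction `κ` with `M_κ` even and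
EVERY translate `t` (the face between `b_κ = t_κ − 1` and `b_κ = t_κ`), on all bounded observables measurable in the block fields of the half torus
`{val (b − t)_κ < M_κ∕2}` (`L ≥ 2`, `K ≥ 1`, `a, m² > 0`). [cite: King1986, (2.6) p.652, (2.14) p.653, (4.5) p.670, (4.41) p.675] [cite: GlimmJaffe1987, §7.10 Thm. 7.10.3] [cite: FILS1978, §2, Thm. 2.1] -/
theorem blockFieldLaw_isReflectionPositive_plane (hL : 2 ≤ L) (hM : Even (M κ)) {a m2 : ℝ} (ha : 0 < a) (hm : 0 < m2) {K' : ℕ} (hK : 1 ≤ K') (t : Tor M) :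
    haveI : NeZero L := ⟨by omega⟩
    IsReflectionPositive (gaussianFieldOfKernel (blockCov L (L ^ K') M a m2 K')) (Function.Involutive.toPerm _ (shiftedRefl_involutive κ t))
      {b : Tor M | ((b - t) κ).val < M κ / 2} := by
  haveI : NeZero L := ⟨by omega⟩
  have hpsd : IsPosSemidefKernel (blockCov L (L ^ K') M a m2 K') := isPosSemidefKernel_inv_of_posDef (effLaplacian_posDef M L hL ha hm hK)
  exact gaussianField_isReflectionPositive_of_vector hpsd (Function.Involutive.toPerm _ (shiftedRefl_involutive κ t))
    (fun b b' => shiftedRefl_invariant κ t (fun b b' v => blockCov_transl L (L ^ K') M a m2 K' b b' v)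
      (fun b b' => blockCov_torRefl L κ (L ^ K') M a m2 K' b b') b b')
    (shiftedRefl_involutive κ t) (shifted_nonneg_of_base κ t (fun b b' v => blockCov_transl L (L ^ K') M a m2 K' b b' v) (blockCov_base_nonneg M κ L hL hM ha hm hK))

end Planes

/-! ## §4 On Bałaban's volumes `Π ℤ∕n` (constant even side): the tree's FILS reflections `reflectBetweenSites κ k`, halves `halfBetweenSites κ k` -/

section FILS

variable {n : ℕ} [NeZero n] (κ : Fin (d + 1))

/-- `val (w + 1) = val w + 1` when `val w < n∕2` (no wrap-around; `n ≥ 1`). [folklore] -/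
theorem val_add_one_of_lt {w : ZMod n} (hw : w.val < n / 2) : (w + 1).val = w.val + 1 := by
  have hn : 0 < n := Nat.pos_of_ne_zero (NeZero.ne n)
  rw [ZMod.val_add, ZMod.val_one_eq_one_mod, Nat.add_mod_mod, Nat.mod_eq_of_lt (by omega)]

/-- `val (w + 1) = (val w + 1) mod n`. [folklore] -/
theorem val_add_one_eq_mod (w : ZMod n) : (w + 1).val = (w.val + 1) % n := by
  rw [ZMod.val_add, ZMod.val_one_eq_one_mod, Nat.add_mod_mod]

/-- ★ **The shifted half IS the tree's `halfBetweenSites`**: on `(ℤ∕n)^{d+1}` with `n` even, `{x | val (x − t)_κ < n∕2} = halfBetweenSites κ (t_κ − 1)`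
(`= {1 ≤ val(x_κ − k) ≤ n∕2}`, `k = t_κ − 1`). [cite: Biskup2009, §5.1 Def. 5.2 (`𝕋_L^+`)] [cite: FILS1978, §2] -/
theorem mem_shiftedHalf_iff_mem_halfBetweenSites (hn : Even n) (t x : Tor (fun _ : Fin (d + 1) => n)) :
    x ∈ {x : Tor (fun _ : Fin (d + 1) => n) | ((x - t) κ).val < n / 2} ↔ x ∈ halfBetweenSites (d := d + 1) (L := n) κ (t κ - 1) := by
  simp only [Set.mem_setOf_eq, halfBetweenSites, Pi.sub_apply]
  have e : x κ - (t κ - 1) = (x κ - t κ) + 1 := by ring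
  rw [e]
  set w : ZMod n := x κ - t κ
  obtain ⟨m, hm⟩ := hn
  have hwlt : w.val < n := ZMod.val_lt _
  constructor
  · intro hw
    rw [val_add_one_of_lt hw]
    omega
  · rintro ⟨h1, h2⟩
    by_contra hw
    push Not at hw
    have hval := val_add_one_eq_mod w
    by_cases htop : w.val + 1 < n
    · rw [Nat.mod_eq_of_lt htop] at hval
      omega
    · have hw1 : w.val + 1 = n := by omega
      rw [hw1, Nat.mod_self] at hval
      omega

omit [NeZero n] in
/-- ★ **The shifted block-face reflection IS the tree's `reflectBetweenSites`**: `σ_κ(x − t) + t = reflectBetweenSites κ (t_κ − 1) x` (`x_κ ↦ 2(t_κ − 1) + 1 − x_κ`).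
[cite: FILS1978, §2] [cite: Biskup2009, §5.1] -/
theorem shiftedRefl_eq_reflectBetweenSites (t x : Tor (fun _ : Fin (d + 1) => n)) :
    torRefl (fun _ : Fin (d + 1) => n) κ (x - t) + t = reflectBetweenSites (d := d + 1) (L := n) κ (t κ - 1) x := by
  rw [reflectBetweenSites_apply]
  funext μ
  by_cases hμ : μ = κ
  · subst hμ
    rw [Pi.add_apply, torRefl_apply_same, Function.update_self, Pi.sub_apply]
    ring
  · rw [Pi.add_apply, torRefl_apply_ne _ hμ, Function.update_of_ne hμ, Pi.sub_apply, sub_add_cancel]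

omit [NeZero n] in
/-- The two reflections agree as permutations. [cite: FILS1978, §2] -/
theorem shiftedReflPerm_eq_reflectBetweenSites (t : Tor (fun _ : Fin (d + 1) => n)) :
    Function.Involutive.toPerm _ (shiftedRefl_involutive (K := fun _ : Fin (d + 1) => n) κ t) = reflectBetweenSites (d := d + 1) (L := n) κ (t κ - 1) :=
  Equiv.ext fun x => shiftedRefl_eq_reflectBetweenSites κ t x

/-- The two halves agree as sets. [cite: Biskup2009, §5.1 Def. 5.2] -/
theorem shiftedHalf_eq_halfBetweenSites (hn : Even n) (t : Tor (fun _ : Fin (d + 1) => n)) :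
    {x : Tor (fun _ : Fin (d + 1) => n) | ((x - t) κ).val < n / 2} = halfBetweenSites (d := d + 1) (L := n) κ (t κ - 1) :=
  Set.ext fun x => mem_shiftedHalf_iff_mem_halfBetweenSites κ hn t x

variable (L : ℕ)

/-- ★★★ **KING's RG BLOCK-FIELD LAWS ARE REFLECTION POSITIVE FOR ALL OF THE TREE's FILS REFLECTIONS BETWEEN SITES**: on the King-model family's tori `Π ℤ∕(2L^m)`
(`kingVol L j = fun _ => 2·L^m`, definitionally), for EVERY index `j`, EVERY direction `κ` and EVERY `k : ℤ∕(2L^m)`,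
`IsReflectionPositive (N(0, (Δ^{(K_j)})⁻¹)) (Torus.reflectBetweenSites κ k) (Torus.halfBetweenSites κ k)` (`L ≥ 2`, `a, m² > 0`) — the hypothesis of the chessboard
estimate ∕ infrared-bound machinery in the tree's own vocabulary. [cite: King1986, (2.14) p.653, (4.41) p.675] [cite: FILS1978, §2, Thm. 2.1] [cite: Biskup2009, §5.1 Def. 5.2] -/
theorem blockFieldLaw_isReflectionPositive_betweenSites (hL : 2 ≤ L) {a m2 : ℝ} (ha : 0 < a) (hm : 0 < m2) (j : KingVolIndex d) (k : ZMod (2 * L ^ j.m)) :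
    haveI : NeZero L := ⟨by omega⟩
    haveI : ∀ μ : Fin (d + 1), NeZero ((fun _ : Fin (d + 1) => 2 * L ^ j.m) μ) := kingVol_neZero L j
    IsReflectionPositive (gaussianFieldOfKernel (blockCov L (L ^ j.K) (fun _ : Fin (d + 1) => 2 * L ^ j.m) a m2 j.K))
      (reflectBetweenSites (d := d + 1) (L := 2 * L ^ j.m) κ k) (halfBetweenSites (d := d + 1) (L := 2 * L ^ j.m) κ k) := by
  haveI : NeZero L := ⟨by omega⟩
  haveI : NeZero (2 * L ^ j.m) := ⟨mul_ne_zero two_ne_zero (pow_ne_zero _ (NeZero.ne L))⟩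
  haveI hI : ∀ μ : Fin (d + 1), NeZero ((fun _ : Fin (d + 1) => 2 * L ^ j.m) μ) := kingVol_neZero L j
  have hev : Even (2 * L ^ j.m) := ⟨L ^ j.m, two_mul _⟩
  -- the translate `t = (k + 1)·e_κ`
  set t : Tor (fun _ : Fin (d + 1) => 2 * L ^ j.m) := Pi.single κ (k + 1) with ht
  have htk : t κ - 1 = k := by rw [ht, Pi.single_eq_same, add_sub_cancel_right]
  have e1 := shiftedReflPerm_eq_reflectBetweenSites κ t
  have e2 := shiftedHalf_eq_halfBetweenSites κ hev t
  rw [htk] at e1 e2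
  rw [← e1, ← e2]
  exact blockFieldLaw_isReflectionPositive_plane (fun _ : Fin (d + 1) => 2 * L ^ j.m) κ L hL hev ha hm j.one_le_K t

/-- … and reflection invariant under every `reflectBetweenSites κ k`. [cite: King1986, (2.14) p.653] [cite: FILS1978, §2] -/
theorem blockFieldLaw_isReflectionInvariant_betweenSites (hL : 2 ≤ L) {a m2 : ℝ} (ha : 0 < a) (hm : 0 < m2) (j : KingVolIndex d) (k : ZMod (2 * L ^ j.m)) :
    haveI : NeZero L := ⟨by omega⟩
    haveI : ∀ μ : Fin (d + 1), NeZero ((fun _ : Fin (d + 1) => 2 * L ^ j.m) μ) := kingVol_neZero L j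
    IsReflectionInvariant (gaussianFieldOfKernel (blockCov L (L ^ j.K) (fun _ : Fin (d + 1) => 2 * L ^ j.m) a m2 j.K))
      (reflectBetweenSites (d := d + 1) (L := 2 * L ^ j.m) κ k) := by
  haveI : NeZero L := ⟨by omega⟩
  haveI : NeZero (2 * L ^ j.m) := ⟨mul_ne_zero two_ne_zero (pow_ne_zero _ (NeZero.ne L))⟩
  haveI hI : ∀ μ : Fin (d + 1), NeZero ((fun _ : Fin (d + 1) => 2 * L ^ j.m) μ) := kingVol_neZero L j
  set t : Tor (fun _ : Fin (d + 1) => 2 * L ^ j.m) := Pi.single κ (k + 1) with ht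
  have htk : t κ - 1 = k := by rw [ht, Pi.single_eq_same, add_sub_cancel_right]
  have hpsd : IsPosSemidefKernel (blockCov L (L ^ j.K) (fun _ : Fin (d + 1) => 2 * L ^ j.m) a m2 j.K) :=
    isPosSemidefKernel_inv_of_posDef (effLaplacian_posDef _ L hL ha hm j.one_le_K)
  have e1 := shiftedReflPerm_eq_reflectBetweenSites κ t
  rw [htk] at e1
  rw [← e1]
  exact gaussianField_isReflectionInvariant hpsd (Function.Involutive.toPerm _ (shiftedRefl_involutive κ t))
    (fun b b' => shiftedRefl_invariant κ t (fun b b' v => blockCov_transl L (L ^ j.K) _ a m2 j.K b b' v)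
      (fun b b' => blockCov_torRefl L κ (L ^ j.K) _ a m2 j.K b b') b b')

/-- ★★ **THE REFLECTION CAUCHY–SCHWARZ INEQUALITY FOR KING's BLOCK FIELDS** (the tree's `rp_cauchySchwarz_holds`): for every FILS reflection between sites and all bounded
half-torus observables `F, G`, `|∫ conj F(ψ∘θ)·G(ψ) dμ^{(K)}|² ≤ Re∫ conj F(ψ∘θ)F(ψ) · Re∫ conj G(ψ∘θ)G(ψ)`. [cite: FILS1978, Thm. 2.1 (proof)] [cite: Biskup2009, §5.1 Lemma 5.3] -/
theorem blockFieldLaw_rp_cauchySchwarz (hL : 2 ≤ L) {a m2 : ℝ} (ha : 0 < a) (hm : 0 < m2) (j : KingVolIndex d) (k : ZMod (2 * L ^ j.m))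
    (F G : (Tor (fun _ : Fin (d + 1) => 2 * L ^ j.m) → ℝ) → ℂ)
    (hF : Measurable[positiveEvents (halfBetweenSites (d := d + 1) (L := 2 * L ^ j.m) κ k)] F) (hFb : ∃ C, ∀ σ', ‖F σ'‖ ≤ C)
    (hG : Measurable[positiveEvents (halfBetweenSites (d := d + 1) (L := 2 * L ^ j.m) κ k)] G) (hGb : ∃ C, ∀ σ', ‖G σ'‖ ≤ C) :
    haveI : NeZero L := ⟨by omega⟩
    haveI : ∀ μ : Fin (d + 1), NeZero ((fun _ : Fin (d + 1) => 2 * L ^ j.m) μ) := kingVol_neZero L j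
    ‖∫ σ', starRingEnd ℂ (F (configReflect (reflectBetweenSites (d := d + 1) (L := 2 * L ^ j.m) κ k) σ')) * G σ'
        ∂(gaussianFieldOfKernel (blockCov L (L ^ j.K) (fun _ : Fin (d + 1) => 2 * L ^ j.m) a m2 j.K))‖ ^ 2 ≤
      (∫ σ', starRingEnd ℂ (F (configReflect (reflectBetweenSites (d := d + 1) (L := 2 * L ^ j.m) κ k) σ')) * F σ'
        ∂(gaussianFieldOfKernel (blockCov L (L ^ j.K) (fun _ : Fin (d + 1) => 2 * L ^ j.m) a m2 j.K))).re *
      (∫ σ', starRingEnd ℂ (G (configReflect (reflectBetweenSites (d := d + 1) (L := 2 * L ^ j.m) κ k) σ')) * G σ'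
        ∂(gaussianFieldOfKernel (blockCov L (L ^ j.K) (fun _ : Fin (d + 1) => 2 * L ^ j.m) a m2 j.K))).re := by
  haveI : NeZero L := ⟨by omega⟩
  haveI : NeZero (2 * L ^ j.m) := ⟨mul_ne_zero two_ne_zero (pow_ne_zero _ (NeZero.ne L))⟩
  haveI hI : ∀ μ : Fin (d + 1), NeZero ((fun _ : Fin (d + 1) => 2 * L ^ j.m) μ) := kingVol_neZero L j
  have hpsd : IsPosSemidefKernel (blockCov L (L ^ j.K) (fun _ : Fin (d + 1) => 2 * L ^ j.m) a m2 j.K) :=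
    isPosSemidefKernel_inv_of_posDef (effLaplacian_posDef _ L hL ha hm j.one_le_K)
  haveI := Literature.MathematicalPhysics.QuantumFieldTheory.isProbabilityMeasure_gaussianFieldOfKernel hpsd
  exact rp_cauchySchwarz_holds (Literature.Probability.LatticeModels.Torus.reflectBetweenSites_involutive κ k)
    (blockFieldLaw_isReflectionPositive_betweenSites κ L hL ha hm j k) (blockFieldLaw_isReflectionInvariant_betweenSites κ L hL ha hm j k) F G hF hFb hG hGb

/-- ★★★ **PART Ϗ BY NAME ON THE KING-MODEL FAMILY** (`L ≥ 2`, `a, m² > 0`, index `j`, torus `Π ℤ∕(2L^m)`): for EVERY direction `κ` and EVERY `k`, King's RG block-field law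
`N(0, (Δ^{(K_j)})⁻¹)` is reflection positive AND reflection invariant for the tree's `reflectBetweenSites κ k` ∕ `halfBetweenSites κ k`; and for every block-face translate
`t`, the block-averaged law `N(0, S₂^{(K_j)})` is reflection positive. [cite: King1986, (2.13)–(2.14) p.653, (4.41) p.675] [cite: FILS1978, §2, Thm. 2.1] [cite: GlimmJaffe1987, §7.10 Thm. 7.10.3] -/
theorem king_torusRP_package (hL : 2 ≤ L) {a m2 : ℝ} (ha : 0 < a) (hm : 0 < m2) (j : KingVolIndex d) :
    haveI : NeZero L := ⟨by omega⟩
    haveI : ∀ μ : Fin (d + 1), NeZero ((fun _ : Fin (d + 1) => 2 * L ^ j.m) μ) := kingVol_neZero L j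
    (∀ (κ : Fin (d + 1)) (k : ZMod (2 * L ^ j.m)),
        IsReflectionPositive (gaussianFieldOfKernel (blockCov L (L ^ j.K) (fun _ : Fin (d + 1) => 2 * L ^ j.m) a m2 j.K))
            (reflectBetweenSites (d := d + 1) (L := 2 * L ^ j.m) κ k) (halfBetweenSites (d := d + 1) (L := 2 * L ^ j.m) κ k)
          ∧ IsReflectionInvariant (gaussianFieldOfKernel (blockCov L (L ^ j.K) (fun _ : Fin (d + 1) => 2 * L ^ j.m) a m2 j.K))
            (reflectBetweenSites (d := d + 1) (L := 2 * L ^ j.m) κ k))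
      ∧ (∀ (κ : Fin (d + 1)) (t : Tor (fun _ : Fin (d + 1) => 2 * L ^ j.m)),
        IsReflectionPositive (gaussianFieldOfKernel (kingS2 (L ^ j.K) (fun _ : Fin (d + 1) => 2 * L ^ j.m) m2))
          (Function.Involutive.toPerm _ (shiftedRefl_involutive κ t)) {b : Tor (fun _ : Fin (d + 1) => 2 * L ^ j.m) | ((b - t) κ).val < 2 * L ^ j.m / 2}) := by
  haveI : NeZero L := ⟨by omega⟩
  haveI hI : ∀ μ : Fin (d + 1), NeZero ((fun _ : Fin (d + 1) => 2 * L ^ j.m) μ) := kingVol_neZero L j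
  refine ⟨fun κ' k => ⟨blockFieldLaw_isReflectionPositive_betweenSites κ' L hL ha hm j k, blockFieldLaw_isReflectionInvariant_betweenSites κ' L hL ha hm j k⟩,
    fun κ' t => ?_⟩
  exact fineBlockLaw_isReflectionPositive_plane (L ^ j.K) (fun _ : Fin (d + 1) => 2 * L ^ j.m) κ' ⟨L ^ j.m, two_mul _⟩ hm t

/-- The King-model family's torus IS `fun _ => 2·L^m` (so the three statements above are statements about `Tor (kingVol L j)`). [cite: Balaban1987RG1, (0.1) p.251] -/
theorem kingVol_eq (j : KingVolIndex d) : kingVol L j = fun _ : Fin (d + 1) => 2 * L ^ j.m := rfl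

end FILS

end Summit.QuantumFields.YangMills.BalabanUVNodes.N15KingModelRung.TorusRP
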